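import Summits.CriticalPhenomena.PercolationContinuityZ3.Theorems.PercNearOneGluingNoHeavyLowerTailIncStarRootTargetStep
import Summits.CriticalPhenomena.PercolationContinuityZ3.Theorems.PercNearOneGluingNoHeavyLowerTailIncStarAnyPairTangent
import Summits.CriticalPhenomena.PercolationContinuityZ3.Theorems.PercNearOneGluingNoHeavyLowerTailFrontierDecRowsPinnedEdgeInduction
import Summits.CriticalPhenomena.PercolationContinuityZ3.Theorems.PercNearOneGluingNoHeavyLowerTailFrontierDecRowsUnmarkedEdgeSymmetry
import HarnessLib

/-!
# The tangent inequality (R23) along a TARGET–TARGET pair: a three-term Harris identity (Sahi programme, prover prim-sahi-p2 gen 32)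

Support file (`--supports stmt-CriticalPhenomena-4575`).  No definitions, no named facts, no sorries; standard axioms.
Memo `run/shared/lean/prim/prim-sahi/FROM-prim-sahi-p2-gen32-TANGENT.md` §9(d)–§10, `prim-sahi-p2/PROOF-E3.md` §42.

`IncStar.incStar_nonneg_of_anyPairRatio23` (this generation) derives the increasing star `E₃({s↔b},{s↔c},{s↔y}) ≥ 0` from R23 — the tangent
inequality `3c₂ ≥ 2c₃`, i.e. `2·E₃(P_{w[g↦1]}) ≤ 3·polar₁(P_{w[g↦1]}, P_{w[g↦0]})` — along ONE fractional non-loop pair `g` per weight, of the prover's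
choice.  Here R23 is PROVED along every pair joining two of the targets.  For `g = s(b,y)` write, under `P⁰ = P_{w[g↦0]}`,
`A = {s↔b}`, `B = {s↔c}`, `C = {s↔y}`, `U = A ∪ C`, `W = {b↔c} ∪ {y↔c}`; opening `g` turns the three star events into `U`, `B ∪ (U ∩ W)`, `U`
(`insert_pair_mem_openConn_iff`), and in the fifteen four-point cells of `(s,b,c,y)` (`FourPointAtoms.cell`) one has the IDENTITY

  `3·polar₁(P¹,P⁰) − 2·E₃(P¹) = (2 − P⁰U)·[P⁰(A∩B∩C) − P⁰(B)·P⁰(A∩C)] + (2 − P⁰U)·P⁰(A △ C)·P⁰(U ∩ W ∖ B) + P⁰(A ∩ C)·P⁰(B ∖ U)`,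

whose three terms are nonnegative (the first by Harris for the increasing events `B` and `A ∩ C`).  (Found from an exact 16-column Harris⊗cell LP
certificate, kit j304542, then simplified by hand; checked as a polynomial identity in the 15 cell variables.)

* `preimage_insertTT_*` — opening `s(b,y)`: the star events become `U`, `B ∪ (U ∩ W)`, `U` (via gen 13's `IncStar.insert_pair_mem_openConn_iff`);
* `tt_cl_*` — the lifted events as sums of four-point cells;
* **`r23_targetTarget`** — R23 along `s(b,y)` for ALL `s b c y` (no distinctness needed); `r23_targetTarget₁₂`, `r23_targetTarget₂₃` — along `s(b,c)` and
  `s(c,y)` (symmetry of `E₃`, `polar₁`);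
* **`incStar_nonneg_of_nonTargetPairRatio23`** — hence (any-pair schema) the increasing star on every finite weighted graph follows from R23 along one
  fractional non-loop pair per weight other than the three target–target pairs: a minimal counterexample has no fractional pair between two targets
  (gen 13's 'marks are independent', recovered through the tangent route).

By contrast, along root–target and target–unmarked pairs the tangent form has no degree-3 Harris⊗cell certificate in the cell algebra and is not even
semantically implied there (memo §10: kit j304915/916) — those classes remain open.
-/

noncomputable section

namespace Summit.CriticalPhenomena.PercolationContinuityZ3.Theorems

namespace IncStar

open MeasureTheory Set Literature.Probability.Percolation Literature.Probability.LatticeModels EdgeInduction FourPointAtoms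
open Summit.CriticalPhenomena.PercolationContinuityZ3.Cruxes.AdditiveGluing.TieLine.ConnAtoms
open scoped Classical

variable {n : ℕ}

/-! ### Opening a pair that avoids the root -/

/-- Self-connection. [folklore] -/
theorem mem_openConn_self_tt (ω : BondConfig (Fin n)) (x : Fin n) : ω ∈ (openConn x x : Set (BondConfig (Fin n))) :=
  SimpleGraph.Reachable.refl _

/-- Opening the target–target pair `s(b,y)` (`s ∉ {b,y}`): `{s↔b}` becomes `{s↔b} ∪ {s↔y}`. [this work] -/
theorem preimage_insertTT_left (s b y : Fin n) :
    (fun ω : BondConfig (Fin n) => insert s(b, y) ω) ⁻¹' openConn s b = openConn s b ∪ openConn s y := by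
  ext ω
  simp only [Set.mem_preimage, Set.mem_union, insert_pair_mem_openConn_iff ω b y s b]
  have hbb := mem_openConn_self_tt ω b
  constructor
  · rintro (h | ⟨h1, -⟩)
    · exact Or.inl h
    · exact h1
  · rintro (h | h)
    · exact Or.inl h
    · exact Or.inr ⟨Or.inr h, Or.inl hbb⟩

/-- Opening `s(b,y)`: `{s↔y}` becomes `{s↔b} ∪ {s↔y}`. [this work] -/
theorem preimage_insertTT_right (s b y : Fin n) :
    (fun ω : BondConfig (Fin n) => insert s(b, y) ω) ⁻¹' openConn s y = openConn s b ∪ openConn s y := by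
  ext ω
  simp only [Set.mem_preimage, Set.mem_union, insert_pair_mem_openConn_iff ω b y s y]
  have hyy := mem_openConn_self_tt ω y
  constructor
  · rintro (h | ⟨h1, -⟩)
    · exact Or.inr h
    · exact h1
  · rintro (h | h)
    · exact Or.inr ⟨Or.inl h, Or.inr hyy⟩
    · exact Or.inl h

/-- Opening `s(b,y)`: `{s↔c}` becomes `{s↔c} ∪ (({s↔b} ∪ {s↔y}) ∩ ({b↔c} ∪ {y↔c}))`. [this work] -/
theorem preimage_insertTT_third (s b y c : Fin n) :
    (fun ω : BondConfig (Fin n) => insert s(b, y) ω) ⁻¹' openConn s c =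
      openConn s c ∪ ((openConn s b ∪ openConn s y) ∩ (openConn b c ∪ openConn y c)) := by
  ext ω
  simp only [Set.mem_preimage, Set.mem_union, Set.mem_inter_iff, insert_pair_mem_openConn_iff ω b y s c]

/-! ### The lifted events in the fifteen four-point cells of `(s,b,c,y)` -/

/-- `μ(openConn s b ∪ openConn s y)` as a sum of four-point cells. [this work] -/
theorem ttU (w : Sym2 (Fin n) → unitInterval) (s b c y : Fin n) : (prodBernoulli w).real (openConn s b ∪ openConn s y) = cell w s b c y 4 + cell w s b c y 6 + cell w s b c y 8 + cell w s b c y 10 + cell w s b c y 11 + cell w s b c y 12 + cell w s b c y 13 + cell w s b c y 14 := by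
  rw [measureReal_eq_cellSum w s b c y (show HasPattern (quad s b c y) (openConn s b ∪ openConn s y) _ from (((oc s b c y 0 1 rfl rfl)).union ((oc s b c y 0 3 rfl rfl))))]
  simp (config := {decide := true}) only [ite_true, ite_false, zero_add, add_zero]

/-- `μ(openConn s c ∪ ((openConn s b ∪ openConn s y) ∩ (openConn b c ∪ openConn y c)))` as a sum of four-point cells. [this work] -/
theorem ttCp (w : Sym2 (Fin n) → unitInterval) (s b c y : Fin n) : (prodBernoulli w).real (openConn s c ∪ ((openConn s b ∪ openConn s y) ∩ (openConn b c ∪ openConn y c))) = cell w s b c y 5 + cell w s b c y 8 + cell w s b c y 9 + cell w s b c y 10 + cell w s b c y 11 + cell w s b c y 13 + cell w s b c y 14 := by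
  rw [measureReal_eq_cellSum w s b c y (show HasPattern (quad s b c y) (openConn s c ∪ ((openConn s b ∪ openConn s y) ∩ (openConn b c ∪ openConn y c))) _ from (((oc s b c y 0 2 rfl rfl)).union ((((((oc s b c y 0 1 rfl rfl)).union ((oc s b c y 0 3 rfl rfl)))).inter ((((oc s b c y 1 2 rfl rfl)).union ((oc s b c y 3 2 rfl rfl))))))))]
  simp (config := {decide := true}) only [ite_true, ite_false, zero_add, add_zero]

/-- `μ(((openConn s b ∪ openConn s y) ∩ (openConn s c ∪ ((openConn s b ∪ openConn s y) ∩ (openConn b c ∪ openConn y c)))) ∩ (openConn s b ∪ openConn s y))` as a sum of four-point cells. [this work] -/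
theorem ttABC (w : Sym2 (Fin n) → unitInterval) (s b c y : Fin n) : (prodBernoulli w).real (((openConn s b ∪ openConn s y) ∩ (openConn s c ∪ ((openConn s b ∪ openConn s y) ∩ (openConn b c ∪ openConn y c)))) ∩ (openConn s b ∪ openConn s y)) = cell w s b c y 8 + cell w s b c y 10 + cell w s b c y 11 + cell w s b c y 13 + cell w s b c y 14 := by
  rw [measureReal_eq_cellSum w s b c y (show HasPattern (quad s b c y) (((openConn s b ∪ openConn s y) ∩ (openConn s c ∪ ((openConn s b ∪ openConn s y) ∩ (openConn b c ∪ openConn y c)))) ∩ (openConn s b ∪ openConn s y)) _ from (((((((oc s b c y 0 1 rfl rfl)).union ((oc s b c y 0 3 rfl rfl)))).inter ((((oc s b c y 0 2 rfl rfl)).union ((((((oc s b c y 0 1 rfl rfl)).union ((oc s b c y 0 3 rfl rfl)))).inter ((((oc s b c y 1 2 rfl rfl)).union ((oc s b c y 3 2 rfl rfl)))))))))).inter ((((oc s b c y 0 1 rfl rfl)).union ((oc s b c y 0 3 rfl rfl))))))]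
  simp (config := {decide := true}) only [ite_true, ite_false, zero_add, add_zero]

/-- `μ((openConn s c ∪ ((openConn s b ∪ openConn s y) ∩ (openConn b c ∪ openConn y c))) ∩ (openConn s b ∪ openConn s y))` as a sum of four-point cells. [this work] -/
theorem ttBC (w : Sym2 (Fin n) → unitInterval) (s b c y : Fin n) : (prodBernoulli w).real ((openConn s c ∪ ((openConn s b ∪ openConn s y) ∩ (openConn b c ∪ openConn y c))) ∩ (openConn s b ∪ openConn s y)) = cell w s b c y 8 + cell w s b c y 10 + cell w s b c y 11 + cell w s b c y 13 + cell w s b c y 14 := by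
  rw [measureReal_eq_cellSum w s b c y (show HasPattern (quad s b c y) ((openConn s c ∪ ((openConn s b ∪ openConn s y) ∩ (openConn b c ∪ openConn y c))) ∩ (openConn s b ∪ openConn s y)) _ from (((((oc s b c y 0 2 rfl rfl)).union ((((((oc s b c y 0 1 rfl rfl)).union ((oc s b c y 0 3 rfl rfl)))).inter ((((oc s b c y 1 2 rfl rfl)).union ((oc s b c y 3 2 rfl rfl)))))))).inter ((((oc s b c y 0 1 rfl rfl)).union ((oc s b c y 0 3 rfl rfl))))))]
  simp (config := {decide := true}) only [ite_true, ite_false, zero_add, add_zero]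

/-- `μ((openConn s b ∪ openConn s y) ∩ (openConn s b ∪ openConn s y))` as a sum of four-point cells. [this work] -/
theorem ttAC (w : Sym2 (Fin n) → unitInterval) (s b c y : Fin n) : (prodBernoulli w).real ((openConn s b ∪ openConn s y) ∩ (openConn s b ∪ openConn s y)) = cell w s b c y 4 + cell w s b c y 6 + cell w s b c y 8 + cell w s b c y 10 + cell w s b c y 11 + cell w s b c y 12 + cell w s b c y 13 + cell w s b c y 14 := by
  rw [measureReal_eq_cellSum w s b c y (show HasPattern (quad s b c y) ((openConn s b ∪ openConn s y) ∩ (openConn s b ∪ openConn s y)) _ from (((((oc s b c y 0 1 rfl rfl)).union ((oc s b c y 0 3 rfl rfl)))).inter ((((oc s b c y 0 1 rfl rfl)).union ((oc s b c y 0 3 rfl rfl))))))]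
  simp (config := {decide := true}) only [ite_true, ite_false, zero_add, add_zero]

/-- `μ((openConn s b ∪ openConn s y) ∩ (openConn s c ∪ ((openConn s b ∪ openConn s y) ∩ (openConn b c ∪ openConn y c))))` as a sum of four-point cells. [this work] -/
theorem ttAB (w : Sym2 (Fin n) → unitInterval) (s b c y : Fin n) : (prodBernoulli w).real ((openConn s b ∪ openConn s y) ∩ (openConn s c ∪ ((openConn s b ∪ openConn s y) ∩ (openConn b c ∪ openConn y c)))) = cell w s b c y 8 + cell w s b c y 10 + cell w s b c y 11 + cell w s b c y 13 + cell w s b c y 14 := by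
  rw [measureReal_eq_cellSum w s b c y (show HasPattern (quad s b c y) ((openConn s b ∪ openConn s y) ∩ (openConn s c ∪ ((openConn s b ∪ openConn s y) ∩ (openConn b c ∪ openConn y c)))) _ from (((((oc s b c y 0 1 rfl rfl)).union ((oc s b c y 0 3 rfl rfl)))).inter ((((oc s b c y 0 2 rfl rfl)).union ((((((oc s b c y 0 1 rfl rfl)).union ((oc s b c y 0 3 rfl rfl)))).inter ((((oc s b c y 1 2 rfl rfl)).union ((oc s b c y 3 2 rfl rfl))))))))))]
  simp (config := {decide := true}) only [ite_true, ite_false, zero_add, add_zero]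

/-- `μ(openConn s c ∩ (openConn s b ∩ openConn s y))` as a sum of four-point cells. [this work] -/
theorem ttH (w : Sym2 (Fin n) → unitInterval) (s b c y : Fin n) : (prodBernoulli w).real (openConn s c ∩ (openConn s b ∩ openConn s y)) = cell w s b c y 14 := by
  rw [measureReal_eq_cellSum w s b c y (show HasPattern (quad s b c y) (openConn s c ∩ (openConn s b ∩ openConn s y)) _ from (((oc s b c y 0 2 rfl rfl)).inter ((((oc s b c y 0 1 rfl rfl)).inter ((oc s b c y 0 3 rfl rfl))))))]
  simp (config := {decide := true}) only [ite_true, ite_false, zero_add, add_zero]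

/-! ### R23 along a target–target pair -/

set_option maxHeartbeats 4000000 in
/-- **R23 (the tangent inequality `3c₂ ≥ 2c₃`) ALONG A TARGET–TARGET PAIR.**  For every weight `w` on the pairs of `Fin n`, root `s` and targets `b, c, y`
(no distinctness hypotheses: coincident points only empty some cells), along `g = s(b,y)`: `2·E₃(P_{w[g↦1]}) ≤ 3·polar₁(P_{w[g↦1]}, P_{w[g↦0]})` for the
star events `{s↔b},{s↔c},{s↔y}`.  Proof: the three-term identity of the module docstring in the fifteen four-point cells, Harris for `{s↔c}` and
`{s↔b}∩{s↔y}`. [this work] -/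
theorem r23_targetTarget (w : Sym2 (Fin n) → unitInterval) (s b c y : Fin n) :
    2 * sahiE3 (prodBernoulli (Function.update w s(b, y) 1)) (openConn s b) (openConn s c) (openConn s y) ≤
      3 * polar₁ (prodBernoulli (Function.update w s(b, y) 1)) (prodBernoulli (Function.update w s(b, y) 0))
        (openConn s b) (openConn s c) (openConn s y) := by
  classical
  set w0 := Function.update w s(b, y) 0 with hw0
  have L : ∀ S : Set (BondConfig (Fin n)), (prodBernoulli (Function.update w s(b, y) 1)).real S =
      (prodBernoulli w0).real ((fun ω : BondConfig (Fin n) => insert s(b, y) ω) ⁻¹' S) := tieLiftOne_real_one_eq w s(b, y)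
  have pA := preimage_insertTT_left s b y
  have pC := preimage_insertTT_right s b y
  have pB := preimage_insertTT_third s b y c
  have l1 : (prodBernoulli (Function.update w s(b, y) 1)).real (openConn s b ∩ openConn s c ∩ openConn s y) = (prodBernoulli w0).real (((openConn s b ∪ openConn s y) ∩ (openConn s c ∪ ((openConn s b ∪ openConn s y) ∩ (openConn b c ∪ openConn y c)))) ∩ (openConn s b ∪ openConn s y)) := by
    rw [L, Set.preimage_inter, Set.preimage_inter, pA, pB, pC]
  have l2 : (prodBernoulli (Function.update w s(b, y) 1)).real (openConn s b) = (prodBernoulli w0).real (openConn s b ∪ openConn s y) := by rw [L, pA]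
  have l3 : (prodBernoulli (Function.update w s(b, y) 1)).real (openConn s c) = (prodBernoulli w0).real (openConn s c ∪ ((openConn s b ∪ openConn s y) ∩ (openConn b c ∪ openConn y c))) := by rw [L, pB]
  have l4 : (prodBernoulli (Function.update w s(b, y) 1)).real (openConn s y) = (prodBernoulli w0).real (openConn s b ∪ openConn s y) := by rw [L, pC]
  have l5 : (prodBernoulli (Function.update w s(b, y) 1)).real (openConn s c ∩ openConn s y) = (prodBernoulli w0).real ((openConn s c ∪ ((openConn s b ∪ openConn s y) ∩ (openConn b c ∪ openConn y c))) ∩ (openConn s b ∪ openConn s y)) := by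
    rw [L, Set.preimage_inter, pB, pC]
  have l6 : (prodBernoulli (Function.update w s(b, y) 1)).real (openConn s b ∩ openConn s y) = (prodBernoulli w0).real ((openConn s b ∪ openConn s y) ∩ (openConn s b ∪ openConn s y)) := by
    rw [L, Set.preimage_inter, pA, pC]
  have l7 : (prodBernoulli (Function.update w s(b, y) 1)).real (openConn s b ∩ openConn s c) = (prodBernoulli w0).real ((openConn s b ∪ openConn s y) ∩ (openConn s c ∪ ((openConn s b ∪ openConn s y) ∩ (openConn b c ∪ openConn y c)))) := by
    rw [L, Set.preimage_inter, pA, pB]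
  rw [sahiE3_def]
  simp only [polar₁, l1, l2, l3, l4, l5, l6, l7]
  rw [ttABC w0 s b c y, ttU w0 s b c y, ttCp w0 s b c y, ttBC w0 s b c y, ttAC w0 s b c y, ttAB w0 s b c y,
    rt_cl_0 w0 s b c y, rt_cl_1 w0 s b c y, rt_cl_2 w0 s b c y, rt_cl_3 w0 s b c y, rt_cl_4 w0 s b c y, rt_cl_5 w0 s b c y, rt_cl_6 w0 s b c y]
  have c0 : (0:ℝ) ≤ cell w0 s b c y 0 := cell_nonneg w0 s b c y 0
  have c1 : (0:ℝ) ≤ cell w0 s b c y 1 := cell_nonneg w0 s b c y 1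
  have c2 : (0:ℝ) ≤ cell w0 s b c y 2 := cell_nonneg w0 s b c y 2
  have c3 : (0:ℝ) ≤ cell w0 s b c y 3 := cell_nonneg w0 s b c y 3
  have c4 : (0:ℝ) ≤ cell w0 s b c y 4 := cell_nonneg w0 s b c y 4
  have c5 : (0:ℝ) ≤ cell w0 s b c y 5 := cell_nonneg w0 s b c y 5
  have c6 : (0:ℝ) ≤ cell w0 s b c y 6 := cell_nonneg w0 s b c y 6
  have c7 : (0:ℝ) ≤ cell w0 s b c y 7 := cell_nonneg w0 s b c y 7
  have c8 : (0:ℝ) ≤ cell w0 s b c y 8 := cell_nonneg w0 s b c y 8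
  have c9 : (0:ℝ) ≤ cell w0 s b c y 9 := cell_nonneg w0 s b c y 9
  have c10 : (0:ℝ) ≤ cell w0 s b c y 10 := cell_nonneg w0 s b c y 10
  have c11 : (0:ℝ) ≤ cell w0 s b c y 11 := cell_nonneg w0 s b c y 11
  have c12 : (0:ℝ) ≤ cell w0 s b c y 12 := cell_nonneg w0 s b c y 12
  have c13 : (0:ℝ) ≤ cell w0 s b c y 13 := cell_nonneg w0 s b c y 13
  have c14 : (0:ℝ) ≤ cell w0 s b c y 14 := cell_nonneg w0 s b c y 14
  have hs := sum_cell_eq_one w0 s b c y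
  -- Harris for {s↔c} and {s↔b} ∩ {s↔y}
  have har := prodBernoulli_harris w0 (isUpperSet_openConn (V := Fin n) s c) ((isUpperSet_openConn (V := Fin n) s b).inter (isUpperSet_openConn (V := Fin n) s y))
    MeasurableSet.of_discrete MeasurableSet.of_discrete
  rw [ttH w0 s b c y, rt_cl_2 w0 s b c y, rt_cl_5 w0 s b c y] at har
  have hh := sub_nonneg.mpr har
  have h2u : (0:ℝ) ≤ 2 - (cell w0 s b c y 4 + cell w0 s b c y 6 + cell w0 s b c y 8 + cell w0 s b c y 10 + cell w0 s b c y 11 + cell w0 s b c y 12 + cell w0 s b c y 13 + cell w0 s b c y 14) := by linarith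
  have hsym : (0:ℝ) ≤ cell w0 s b c y 4 + cell w0 s b c y 6 + cell w0 s b c y 8 + cell w0 s b c y 10 + cell w0 s b c y 11 + cell w0 s b c y 13 := by linarith
  have hdel : (0:ℝ) ≤ cell w0 s b c y 8 + cell w0 s b c y 11 := by linarith
  have hm : (0:ℝ) ≤ cell w0 s b c y 12 + cell w0 s b c y 14 := by linarith
  have hrest : (0:ℝ) ≤ cell w0 s b c y 5 + cell w0 s b c y 9 := by linarith
  nlinarith [mul_nonneg h2u hh, mul_nonneg (mul_nonneg h2u hsym) hdel, mul_nonneg hm hrest]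
/-! ### The other two target–target pairs, by symmetry -/

/-- R23 along the target–target pair `s(b,c)`. [this work] -/
theorem r23_targetTarget₁₂ (w : Sym2 (Fin n) → unitInterval) (s b c y : Fin n) :
    2 * sahiE3 (prodBernoulli (Function.update w s(b, c) 1)) (openConn s b) (openConn s c) (openConn s y) ≤
      3 * polar₁ (prodBernoulli (Function.update w s(b, c) 1)) (prodBernoulli (Function.update w s(b, c) 0))
        (openConn s b) (openConn s c) (openConn s y) := by
  have h := r23_targetTarget w s b y c
  rw [sahiE3_comm₂₃, TerminalEdgeInduction.polar₁_swap₂₃] at h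
  exact h

/-- R23 along the target–target pair `s(c,y)`. [this work] -/
theorem r23_targetTarget₂₃ (w : Sym2 (Fin n) → unitInterval) (s b c y : Fin n) :
    2 * sahiE3 (prodBernoulli (Function.update w s(c, y) 1)) (openConn s b) (openConn s c) (openConn s y) ≤
      3 * polar₁ (prodBernoulli (Function.update w s(c, y) 1)) (prodBernoulli (Function.update w s(c, y) 0))
        (openConn s b) (openConn s c) (openConn s y) := by
  have h := r23_targetTarget w s c b y
  rw [sahiE3_comm₁₂, TerminalEdgeInduction.polar₁_swap₁₂] at h
  exact h

/-! ### Consequence for the induction -/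

/-- **THE INCREASING STAR FROM R23 ALONG ONE NON-TARGET–TARGET PAIR.**  Suppose that for every weight `v` and all `s b c y` such that `v` has a fractional
non-loop pair OTHER than `s(b,c), s(b,y), s(c,y)` — and GIVEN the increasing star for every weight with fewer fractional pairs and every marking — SOME fractional
non-loop pair satisfies R23 for the star events.  Then the increasing star holds on every finite weighted graph.  (Target–target pairs are discharged by
`r23_targetTarget`; so a minimal counterexample to the increasing star has no fractional pair between two of its targets — gen 13's 'marks are independent',
recovered through the tangent route — and violates R23 along every other fractional non-loop pair.) [this work] -/
theorem incStar_nonneg_of_nonTargetPairRatio23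
    (hR : ∀ (v : Sym2 (Fin n) → unitInterval) (s b c y : Fin n),
      (∃ g ∈ fracEdges v, ¬ g.IsDiag ∧ g ≠ s(b, c) ∧ g ≠ s(b, y) ∧ g ≠ s(c, y)) →
      (∀ v' : Sym2 (Fin n) → unitInterval, (fracEdges v').card < (fracEdges v).card →
          ∀ s' b' c' y' : Fin n, 0 ≤ sahiE3 (prodBernoulli v') (openConn s' b') (openConn s' c') (openConn s' y')) →
      ∃ g ∈ fracEdges v, ¬ g.IsDiag ∧
        2 * sahiE3 (prodBernoulli (Function.update v g 1)) (openConn s b) (openConn s c) (openConn s y) ≤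
          3 * polar₁ (prodBernoulli (Function.update v g 1)) (prodBernoulli (Function.update v g 0)) (openConn s b) (openConn s c) (openConn s y)) :
    ∀ (w : Sym2 (Fin n) → unitInterval) (s b c y : Fin n),
      0 ≤ sahiE3 (prodBernoulli w) (openConn s b) (openConn s c) (openConn s y) := by
  refine incStar_nonneg_of_anyPairRatio23 fun v s b c y hex IH => ?_
  by_cases h1 : s(b, c) ∈ fracEdges v ∧ ¬ (s(b, c) : Sym2 (Fin n)).IsDiag
  · exact ⟨s(b, c), h1.1, h1.2, r23_targetTarget₁₂ v s b c y⟩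
  by_cases h2 : s(b, y) ∈ fracEdges v ∧ ¬ (s(b, y) : Sym2 (Fin n)).IsDiag
  · exact ⟨s(b, y), h2.1, h2.2, r23_targetTarget v s b c y⟩
  by_cases h3 : s(c, y) ∈ fracEdges v ∧ ¬ (s(c, y) : Sym2 (Fin n)).IsDiag
  · exact ⟨s(c, y), h3.1, h3.2, r23_targetTarget₂₃ v s b c y⟩
  refine hR v s b c y ?_ IH
  obtain ⟨g, hg, hgd⟩ := hex
  refine ⟨g, hg, hgd, ?_, ?_, ?_⟩
  · rintro rfl; exact h1 ⟨hg, hgd⟩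
  · rintro rfl; exact h2 ⟨hg, hgd⟩
  · rintro rfl; exact h3 ⟨hg, hgd⟩

end IncStar

end Summit.CriticalPhenomena.PercolationContinuityZ3.Theorems

end
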